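import Literature.Topology.FourManifolds.ScalingFamily
import HarnessLib

/-!
# The scaling family over an abstract wall frame

Topic `Literature/Topology/FourManifolds` (trunk T-4MAN). Fact seat
`provefact-Literature.Topology.FourManifolds.Knot.IsConnectedSum.isIsotopic` (Schubert's theorem),
geometric heart for rail knots. `ScalingFamily.lean` contracts the southern content of the
*spiked knot* of band-sum data `b` towards the centre `oS`; the embeddedness of that family only
uses, of the part of the spiked knot *off* the content set (the **walls**), a classification of
its points into four kinds (`ConeGeometry.wall_cases`). The later stages of the proof (hosts,
hybrids of two presentations, transported blobs) contract the *same* southern content of `b`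
inside loops which differ from the spiked knot off the extended region. This file therefore
redoes the construction for an **abstract wall frame**: a piece function `F : ℝ → ℝ⁴` which is a
simple regular loop of period one based at `b.alo`, agrees with the spiked piece function of `b`
on the open extended region `{αLo > 1/4, αHi > 1/4}`, and whose points off the content set are
**wall points** (`BandData.IsWallPt`):

* (W1) / (W1') `ψ⁻¹` of the final lower / upper piece at a flat parameter `α ∈ [0, 3/8)`;
* (W2) a point of the far set of threshold `min (r/2) (min gapLo gapHi)` in the closed northern
  hemisphere;
* (W4) a point `x'` of the closed northern hemisphere whose chart value (if `x'` is not the north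
  pole) has first blow-up coordinate `< 3/8`.

Contents: the **cone condition for wall points** (`cone_of_isWallPt`: every chord from `oS` to the
chart value of a content point, read back on the sphere, avoids every wall point — first blow-up
coordinate against (W1), (W1'), (W4) for local content, depth / hemispheres for far content, the
far-regime separation against (W2)); the wall points of the spiked knot itself
(`isWallPt_spikePiece_one`, from `wall_cases`); the structure `BandData.IsWallFrame h F`; the
family `b.wallScalePiece h F lam₀ u = F + regionTheta • (ψ⁻¹ Z - F)` (with the scaled chart point
`Z = b.scalePt h lam₀ u` of `ScalingFamily.lean`, so that the contracted content is *literally the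
same* for every wall frame), its agreement with `b.scalePiece` on the open extended region and with
`F` off it, smoothness, regularity, injectivity and disjointness from the walls; the **shrunk wall
frame knot** `b.wallShrinkKnot H hW hB hAB` and the isotopy
`isIsotopic_toKnot_wallShrinkKnot : toKnot (periodise alo F) ≃ wallShrinkKnot`; and the instance
`F = spikePiece` (`isWallFrame_spikePiece`, `wallShrinkKnot_spikePiece : … = b.shrinkKnot …`).

Everything is proved; no named facts are introduced.

## References

* M. W. Hirsch, *Differential Topology*, GTM 33, Springer (1976), Ch. 8 §1, Thm. 1.3.
  [HirschDT1976]
-/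

open scoped Manifold ContDiff Topology Real
open Function Set Metric Filter

noncomputable section

namespace Literature.Topology.FourManifolds

/-- Local notation: `𝔼 n` is the model Euclidean space `EuclideanSpace ℝ (Fin n)`. -/
local notation "𝔼 " n:arg => EuclideanSpace ℝ (Fin n)

/-- Local notation: `𝕊 n` is the unit sphere in `EuclideanSpace ℝ (Fin (n + 1))`. -/
local notation "𝕊 " n:arg => (Metric.sphere (0 : EuclideanSpace ℝ (Fin (n + 1))) 1)

attribute [local instance] fact_finrank_euclideanSpace_succ

open KnotsInBall

namespace BandData

variable {A B K : Knot} {avoid : Set (𝕊 3)} (b : BandData A B K avoid)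
  (hcross : b.band ⁻¹' sphereEquator 2 ∩ squareNhd b.δ = {x ∈ squareNhd b.δ | x 0 = 2⁻¹})

/-! ### Wall points -/

/-- **Wall points** (at flat radius `r` and scale `κ`): (W1) `ψ⁻¹` of the final lower piece at a
flat parameter `α ∈ [0, 3/8)`; (W1') the same for the upper piece; (W2) a point of the far set of
threshold `min (r/2) (min gapLo gapHi)` in the closed northern hemisphere; (W4) a point of the
closed northern hemisphere whose chart value has first blow-up coordinate `< 3/8`. [folklore] -/
def IsWallPt (r κ : ℝ) (x : 𝔼 4) : Prop :=
  (∃ α ∈ Ico (0 : ℝ) (3 / 8), κ * (|α| + 1) < r ∧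
      x = ((psiN.symm (b.pieceLo hcross κ b.depthSign 1 α) : 𝕊 3) : 𝔼 4)) ∨
    (∃ α ∈ Ico (0 : ℝ) (3 / 8), κ * (|α| + 1) < r ∧
      x = ((psiN.symm (b.pieceHi hcross κ b.depthSign 1 α) : 𝕊 3) : 𝔼 4)) ∨
    (x ∈ b.farSet (min (r / 2) (min b.gapLo b.gapHi)) ∧
      ∃ x' : 𝕊 3, x = (x' : 𝔼 4) ∧ 0 ≤ (x' : 𝔼 4) (Fin.last 3)) ∨
    (∃ x' : 𝕊 3, x = (x' : 𝔼 4) ∧ 0 ≤ (x' : 𝔼 4) (Fin.last 3) ∧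
      (x' ≠ northPole → b.blowUp hcross κ (psiN x') 0 < 3 / 8))

variable {hcross} {ε r A' κ : ℝ} (h : b.ConeScale hcross ε r A' κ)
include h

/-- **THE CONE CONDITION FOR WALL POINTS.** At a cone scale (`B` south), every chord from the
centre `oS` to the chart value of a content point of the spiked knot, read back on the sphere,
avoids every wall point. [folklore] -/
theorem cone_of_isWallPt (hB : B.InSouth) {s : ℝ}
    (hs : s ∈ b.contentSet h.spike.κ_pos h.spike.seven_le_gapLo h.spike.seven_le_gapHi)
    {μ : ℝ} (hμ : μ ∈ Icc (0 : ℝ) 1) {x : 𝔼 4} (hx : b.IsWallPt hcross r κ x) :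
    ((psiN.symm (b.oS hcross κ b.depthSign + μ • (b.Ypt h s - b.oS hcross κ b.depthSign)) : 𝕊 3) : 𝔼 4) ≠ x := by
  have hκ := h.spike.κ_pos
  have hf := h.spike.flat
  have hε := h.eps_le
  have hεn := hf.eps_nonneg
  have h8 := h.spike.eight_lt_r
  have hm0 := b.mZero_pos hcross hB
  have hoS := b.depth_oS_pos h hB
  have hoS' := b.depth_oS_ge' h hB
  set o := b.oS hcross κ b.depthSign
  intro heq
  rcases hx with ⟨α, hα, hqt, rfl⟩ | ⟨α, hα, hqt, rfl⟩ | ⟨hfar, x', hx', hxN⟩ | ⟨x', hx', hxN, hfirst⟩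
  · -- (W1) flat lower wall
    have hfirst := b.blowUp_pieceLo_one_zero_lt hf hκ hε (σ := b.depthSign) hα.2 hqt
    have hyq := coe_psiN_symm_injective heq
    rcases b.content_cases h hs with ⟨-, hαs, hqs, -, hY⟩ | ⟨-, hαs, hqs, -, hY⟩ | hfarS
    · have hYf := b.le_blowUp_pieceLo_one_zero hf hκ hε (σ := b.depthSign) hαs hqs
      rw [hY] at hyq
      exact b.chord_ne_of_blowUp_zero hcross hκ.ne' _ hμ hYf hfirst hyq
    · have hYf := b.le_blowUp_pieceHi_one_zero hf hκ hε (σ := b.depthSign) hαs hqs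
      rw [hY] at hyq
      exact b.chord_ne_of_blowUp_zero hcross hκ.ne' _ hμ hYf hfirst hyq
    · have hYd : κ * b.mZero ≤ depth (b.Ypt h s) := b.depth_far h _ hfarS
      have hwd := b.depth_pieceLo_one_le hB hf hκ hε hα.1 hα.2 hqt
      have hlt : depth (b.pieceLo hcross κ b.depthSign 1 α) < κ * b.mZero / 2 := by
        have : b.mZero * (3 / 8 + 11 * ε / 8) < b.mZero / 2 := by nlinarith
        nlinarith
      exact chord_ne_of_depth hoS' (by have := mul_pos hκ hm0; linarith) hμ hlt hyq
  · -- (W1') flat upper wall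
    have hfirst := b.blowUp_pieceHi_one_zero_lt hf hκ hε (σ := b.depthSign) hα.2 hqt
    have hyq := coe_psiN_symm_injective heq
    rcases b.content_cases h hs with ⟨-, hαs, hqs, -, hY⟩ | ⟨-, hαs, hqs, -, hY⟩ | hfarS
    · have hYf := b.le_blowUp_pieceLo_one_zero hf hκ hε (σ := b.depthSign) hαs hqs
      rw [hY] at hyq
      exact b.chord_ne_of_blowUp_zero hcross hκ.ne' _ hμ hYf hfirst hyq
    · have hYf := b.le_blowUp_pieceHi_one_zero hf hκ hε (σ := b.depthSign) hαs hqs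
      rw [hY] at hyq
      exact b.chord_ne_of_blowUp_zero hcross hκ.ne' _ hμ hYf hfirst hyq
    · have hYd : κ * b.mZero ≤ depth (b.Ypt h s) := b.depth_far h _ hfarS
      have hwd := b.depth_pieceHi_one_le hB hf hκ hε hα.1 hα.2 hqt
      have hlt : depth (b.pieceHi hcross κ b.depthSign 1 α) < κ * b.mZero / 2 := by
        have : b.mZero * (3 / 8 + 11 * ε / 8) < b.mZero / 2 := by nlinarith
        nlinarith
      exact chord_ne_of_depth hoS' (by have := mul_pos hκ hm0; linarith) hμ hlt hyq
  · -- (W2) far wall in the closed northern hemisphere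
    rcases b.content_cases h hs with ⟨-, hαs, hqs, -, hY⟩ | ⟨-, hαs, hqs, -, hY⟩ | hfarS
    · by_cases h4 : b.alphaLo κ s ≤ 4
      · -- local content: the chord stays near the crossing point
        have hε1 : ε * (|b.alphaLo κ s| + 1) ≤ 1 := by rw [abs_of_nonneg (by linarith)]; nlinarith
        have hYn : ‖b.blowUp hcross κ (b.Ypt h s)‖ ≤ 7 := by
          rw [hY]
          refine (b.norm_blowUp_pieceLo_le hf hκ ⟨zero_le_one, le_rfl⟩ _ hqs hε1).trans ?_
          rw [abs_of_nonneg (by linarith)]; linarith [b.abs_depthSign_le]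
        have hnot := b.psiN_symm_not_mem_farSet_half h (b.norm_chord_sub_pZero_le h hYn hμ)
        rw [← heq] at hfar
        exact hnot hfar
      · -- beyond the model range: the content point is a southern rail point
        push Not at h4
        have hrail : b.Ypt h s = b.railLoPsi κ (b.alphaLo κ s) := by
          rw [hY]; exact b.pieceLo_eq_rail hcross (fun hm ↦ by linarith [hm.2])
        have hYpos : 0 < depth (b.Ypt h s) := by
          rw [hrail]; exact b.depth_railLoPsi_pos h hB (by linarith) (norm_railLoParam_lt hκ hqs)
        have hne := psiN_symm_chord_ne_of_north hoS hYpos hμ hxN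
        exact hne (Subtype.ext (heq.trans hx'))
    · by_cases h4 : b.alphaHi κ s ≤ 4
      · have hε1 : ε * (|b.alphaHi κ s| + 1) ≤ 1 := by rw [abs_of_nonneg (by linarith)]; nlinarith
        have hYn : ‖b.blowUp hcross κ (b.Ypt h s)‖ ≤ 7 := by
          rw [hY]
          refine (b.norm_blowUp_pieceHi_le hf hκ ⟨zero_le_one, le_rfl⟩ _ hqs hε1).trans ?_
          rw [abs_of_nonneg (by linarith)]; linarith [b.abs_depthSign_le]
        have hnot := b.psiN_symm_not_mem_farSet_half h (b.norm_chord_sub_pZero_le h hYn hμ)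
        rw [← heq] at hfar
        exact hnot hfar
      · push Not at h4
        have hrail : b.Ypt h s = b.railHiPsi κ (b.alphaHi κ s) := by
          rw [hY]; exact b.pieceHi_eq_rail hcross (fun hm ↦ by linarith [hm.2])
        have hYpos : 0 < depth (b.Ypt h s) := by
          rw [hrail]; exact b.depth_railHiPsi_pos h hB (by linarith) (norm_railHiParam_lt hκ hqs)
        have hne := psiN_symm_chord_ne_of_north hoS hYpos hμ hxN
        exact hne (Subtype.ext (heq.trans hx'))
    · have hYd : κ * b.mZero ≤ depth (b.Ypt h s) := b.depth_far h _ hfarS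
      have hYpos : 0 < depth (b.Ypt h s) := by nlinarith
      have hne := psiN_symm_chord_ne_of_north hoS hYpos hμ hxN
      exact hne (Subtype.ext (heq.trans hx'))
  · -- (W4) closed-north point with first blow-up coordinate `< 3/8`
    have hxe : psiN.symm (o + μ • (b.Ypt h s - o)) = x' := Subtype.ext (heq.trans hx')
    rcases b.content_cases h hs with ⟨-, hαs, hqs, -, hY⟩ | ⟨-, hαs, hqs, -, hY⟩ | hfarS
    · have hYf := b.le_blowUp_pieceLo_one_zero hf hκ hε (σ := b.depthSign) hαs hqs
      rw [← hY] at hYf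
      have hP := b.le_blowUp_chord_zero hcross hκ.ne' b.depthSign hμ hYf
      have hne : x' ≠ northPole := by rw [← hxe]; exact psiN_symm_ne_northPole _
      have h1 := hfirst hne
      rw [← hxe, psiN_apply_psiN_symm] at h1
      exact absurd hP (not_le.2 h1)
    · have hYf := b.le_blowUp_pieceHi_one_zero hf hκ hε (σ := b.depthSign) hαs hqs
      rw [← hY] at hYf
      have hP := b.le_blowUp_chord_zero hcross hκ.ne' b.depthSign hμ hYf
      have hne : x' ≠ northPole := by rw [← hxe]; exact psiN_symm_ne_northPole _
      have h1 := hfirst hne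
      rw [← hxe, psiN_apply_psiN_symm] at h1
      exact absurd hP (not_le.2 h1)
    · have hYd : κ * b.mZero ≤ depth (b.Ypt h s) := b.depth_far h _ hfarS
      have hYpos : 0 < depth (b.Ypt h s) := by nlinarith
      exact psiN_symm_chord_ne_of_north hoS hYpos hμ hxN hxe

/-- **The wall points of the spiked knot**: in normal position (`A` north), every point of the
spiked knot off the content set is a wall point (`wall_cases`; a flat bridge point of negative
blown-up parameter is of kind (W4)). [folklore] -/
theorem isWallPt_spikePiece_one (hA : A.InNorth) {t : ℝ} (ht : t ∈ Ico b.alo (b.alo + 1))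
    (hts : t ∉ b.contentSet h.spike.κ_pos h.spike.seven_le_gapLo h.spike.seven_le_gapHi) :
    b.IsWallPt hcross r κ (b.spikePiece hcross κ b.depthSign 1 t) := by
  have hκ := h.spike.κ_pos
  have hf := h.spike.flat
  have hε := h.eps_le
  rcases b.wall_cases h hA ht hts with ⟨htc, hαt, hqt, hwt⟩ | ⟨htc, hαt, hqt, hwt⟩ | ⟨hfar, x, hx, hxN⟩
  · rcases le_or_gt 0 (b.alphaLo κ t) with hα0 | hα0
    · exact Or.inl ⟨_, ⟨hα0, hαt⟩, hqt, hwt⟩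
    · obtain ⟨x, hx, hxN⟩ := b.spikePiece_one_north_of_alphaLo_neg h.spike hA htc hα0
      refine Or.inr (Or.inr (Or.inr ⟨x, hx, hxN.le, fun _ ↦ ?_⟩))
      have hxe : x = psiN.symm (b.pieceLo hcross κ b.depthSign 1 (b.alphaLo κ t)) :=
        Subtype.ext (hx.symm.trans hwt)
      rw [hxe, psiN_apply_psiN_symm]
      exact b.blowUp_pieceLo_one_zero_lt hf hκ hε (σ := b.depthSign) hαt hqt
  · rcases le_or_gt 0 (b.alphaHi κ t) with hα0 | hα0
    · exact Or.inr (Or.inl ⟨_, ⟨hα0, hαt⟩, hqt, hwt⟩)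
    · obtain ⟨x, hx, hxN⟩ := b.spikePiece_one_north_of_alphaHi_neg h.spike hA htc hα0
      refine Or.inr (Or.inr (Or.inr ⟨x, hx, hxN.le, fun _ ↦ ?_⟩))
      have hxe : x = psiN.symm (b.pieceHi hcross κ b.depthSign 1 (b.alphaHi κ t)) :=
        Subtype.ext (hx.symm.trans hwt)
      rw [hxe, psiN_apply_psiN_symm]
      exact b.blowUp_pieceHi_one_zero_lt hf hκ hε (σ := b.depthSign) hαt hqt
  · exact Or.inr (Or.inr (Or.inl ⟨hfar, x, hx, hxN.le⟩))

/-! ### Wall frames -/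

/-- **Wall frames** of `b` at the cone scale `h`: a `C^∞` piece function `F` with the seam property
at `b.alo`, whose periodisation is a regular loop, injective on the fundamental domain, equal to
the spiked piece function of `b` on the open extended region `{αLo > 1/4, αHi > 1/4}`, and whose
points off the content set are wall points. [folklore] -/
structure IsWallFrame (F : ℝ → 𝔼 4) : Prop where
  contDiff : ContDiff ℝ ∞ F
  seam : ∀ t ∈ Ioo (b.alo - b.seamEps) (b.alo + b.seamEps), F (t + 1) = F t
  isRegularLoop : IsRegularLoop (periodise b.alo F)
  injOn : InjOn F (Ico b.alo (b.alo + 1))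
  agree : ∀ s, 1 / 4 < b.alphaLo κ s → 1 / 4 < b.alphaHi κ s → F s = b.spikePiece hcross κ b.depthSign 1 s
  wall : ∀ t ∈ Ico b.alo (b.alo + 1),
    t ∉ b.contentSet h.spike.κ_pos h.spike.seven_le_gapLo h.spike.seven_le_gapHi → b.IsWallPt hcross r κ (F t)

/-- **The spiked piece function is a wall frame** (in normal position, summands disjoint).
[folklore] -/
theorem isWallFrame_spikePiece (hA : A.InNorth) (hAB : Disjoint (range A) (range B)) :
    b.IsWallFrame h (b.spikePiece hcross κ b.depthSign 1) where
  contDiff := b.contDiff_spikePiece_stage hcross h.spike.κ_pos h.spike.eight_le_poleRad b.depthSign 1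
  seam := b.spikePiece_one_seam h
  isRegularLoop := b.isRegularLoop_spikeLoop h.spike ⟨zero_le_one, le_rfl⟩
  injOn := b.injOn_spikePiece_Ico h.spike hAB ⟨zero_le_one, le_rfl⟩
  agree _ _ _ := rfl
  wall _ ht hts := b.isWallPt_spikePiece_one h hA ht hts

/-! ### The scaling family over a wall frame -/

variable (F : ℝ → 𝔼 4)

/-- **The scaling family over the wall frame `F`**: `F + regionTheta • (ψ⁻¹ Z - F)` with the scaled
chart point `Z = b.scalePt h lam₀ u` of the spiked knot. [folklore] -/
def wallScalePiece (lam₀ u s : ℝ) : 𝔼 4 :=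
  F s + b.regionTheta κ s • (((psiN.symm (b.scalePt h lam₀ u s) : 𝕊 3) : 𝔼 4) - F s)

/-- Over the spiked piece function itself the family is the scaling family of `ScalingFamily.lean`.
[folklore] -/
@[simp] theorem wallScalePiece_spikePiece (lam₀ u : ℝ) :
    b.wallScalePiece h (b.spikePiece hcross κ b.depthSign 1) lam₀ u = b.scalePiece h lam₀ u := rfl

variable {F}

/-- Off the open extended region the family is `F`. [folklore] -/
theorem wallScalePiece_eq_of_not_region (lam₀ u : ℝ) {s : ℝ} (hs : ¬ (1 / 4 < b.alphaLo κ s ∧ 1 / 4 < b.alphaHi κ s)) :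
    b.wallScalePiece h F lam₀ u s = F s := by
  have hθ : b.regionTheta κ s = 0 := by
    by_contra hθ
    exact hs (b.alpha_gt_of_regionTheta_ne_zero hθ)
  rw [wallScalePiece, hθ, zero_smul, add_zero]

/-- **On the open extended region the family of a wall frame is the scaling family.** [folklore] -/
theorem wallScalePiece_eq_of_region (hW : b.IsWallFrame h F) (lam₀ u : ℝ) {s : ℝ} (h1 : 1 / 4 < b.alphaLo κ s)
    (h2 : 1 / 4 < b.alphaHi κ s) : b.wallScalePiece h F lam₀ u s = b.scalePiece h lam₀ u s := by
  rw [wallScalePiece, hW.agree s h1 h2]; rfl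

/-- The family of a wall frame is eventually equal, near a point of the open extended region, to the
scaling family. [folklore] -/
theorem wallScalePiece_eventuallyEq (hW : b.IsWallFrame h F) (lam₀ u : ℝ) {s : ℝ} (h1 : 1 / 4 < b.alphaLo κ s)
    (h2 : 1 / 4 < b.alphaHi κ s) : b.wallScalePiece h F lam₀ u =ᶠ[𝓝 s] b.scalePiece h lam₀ u := by
  have hopen : IsOpen {s' : ℝ | 1 / 4 < b.alphaLo κ s' ∧ 1 / 4 < b.alphaHi κ s'} :=
    (isOpen_lt continuous_const (b.contDiff_alphaLo κ).continuous).inter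
      (isOpen_lt continuous_const (b.contDiff_alphaHi κ).continuous)
  filter_upwards [hopen.mem_nhds (show s ∈ {s' | _} from ⟨h1, h2⟩)] with s' hs'
  exact b.wallScalePiece_eq_of_region h hW lam₀ u hs'.1 hs'.2

/-- **Off the content set the family of a wall frame is `F`.** [folklore] -/
theorem wallScalePiece_eq_of_not_mem (hW : b.IsWallFrame h F) (hB : B.InSouth) (lam₀ u : ℝ) {s : ℝ}
    (hs : s ∉ b.contentSet h.spike.κ_pos h.spike.seven_le_gapLo h.spike.seven_le_gapHi) :
    b.wallScalePiece h F lam₀ u s = F s := by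
  by_cases hreg : 1 / 4 < b.alphaLo κ s ∧ 1 / 4 < b.alphaHi κ s
  · rw [b.wallScalePiece_eq_of_region h hW lam₀ u hreg.1 hreg.2, b.scalePiece_eq_of_not_mem h hB lam₀ u hs,
      hW.agree s hreg.1 hreg.2]
  · exact b.wallScalePiece_eq_of_not_region h lam₀ u hreg

/-- **At `u = 0` the family of a wall frame is `F`.** [folklore] -/
theorem wallScalePiece_zero (hW : b.IsWallFrame h F) (hB : B.InSouth) (lam₀ s : ℝ) :
    b.wallScalePiece h F lam₀ 0 s = F s := by
  by_cases hreg : 1 / 4 < b.alphaLo κ s ∧ 1 / 4 < b.alphaHi κ s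
  · rw [b.wallScalePiece_eq_of_region h hW lam₀ 0 hreg.1 hreg.2, b.scalePiece_zero h hB, hW.agree s hreg.1 hreg.2]
  · exact b.wallScalePiece_eq_of_not_region h lam₀ 0 hreg

/-- On the content set the family of a wall frame is the scaling family. [folklore] -/
theorem wallScalePiece_eq_scalePiece_of_mem (hW : b.IsWallFrame h F) (lam₀ u : ℝ) {s : ℝ}
    (hs : s ∈ b.contentSet h.spike.κ_pos h.spike.seven_le_gapLo h.spike.seven_le_gapHi) :
    b.wallScalePiece h F lam₀ u s = b.scalePiece h lam₀ u s := by
  obtain ⟨hα1, hα2⟩ := b.alpha_ge_of_mem_contentSet h hs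
  exact b.wallScalePiece_eq_of_region h hW lam₀ u (by linarith) (by linarith)

/-- **On the content set the family is `ψ⁻¹ (Z u s)`** — the same contracted content for every wall
frame. [folklore] -/
theorem wallScalePiece_eq_of_mem (hW : b.IsWallFrame h F) (lam₀ u : ℝ) {s : ℝ}
    (hs : s ∈ b.contentSet h.spike.κ_pos h.spike.seven_le_gapLo h.spike.seven_le_gapHi) :
    b.wallScalePiece h F lam₀ u s = ((psiN.symm (b.scalePt h lam₀ u s) : 𝕊 3) : 𝔼 4) := by
  rw [b.wallScalePiece_eq_scalePiece_of_mem h hW lam₀ u hs, b.scalePiece_eq_of_mem h lam₀ u hs]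

/-- The family of a wall frame is a unit vector on the content set. [folklore] -/
theorem norm_wallScalePiece_of_mem (hW : b.IsWallFrame h F) (lam₀ u : ℝ) {s : ℝ}
    (hs : s ∈ b.contentSet h.spike.κ_pos h.spike.seven_le_gapLo h.spike.seven_le_gapHi) :
    ‖b.wallScalePiece h F lam₀ u s‖ = 1 := by
  rw [b.wallScalePiece_eq_of_mem h hW lam₀ u hs]; exact norm_eq_of_mem_sphere _

/-- **The family of a wall frame is jointly `C^∞` in `(u, s)`** (off the closed extended region the
region cut-off vanishes identically nearby; on it all terms are smooth). [folklore] -/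
theorem contDiff_wallScalePiece (hW : b.IsWallFrame h F) (hB : B.InSouth) (lam₀ : ℝ) :
    ContDiff ℝ ∞ (uncurry (b.wallScalePiece h F lam₀)) := by
  have hF : ContDiff ℝ ∞ (fun p : ℝ × ℝ ↦ F p.2) := hW.contDiff.comp contDiff_snd
  have hθ : ContDiff ℝ ∞ (fun p : ℝ × ℝ ↦ b.regionTheta κ p.2) := (b.contDiff_regionTheta κ).comp contDiff_snd
  have hT : ContDiff ℝ ∞ (fun p : ℝ × ℝ ↦ b.regionTheta κ p.2 •
      ((((psiN.symm (b.scalePt h lam₀ p.1 p.2)) : 𝕊 3) : 𝔼 4) - F p.2)) := by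
    rw [contDiff_iff_contDiffAt]
    rintro ⟨u, s⟩
    by_cases hreg : 1 / 4 ≤ b.alphaLo κ s ∧ 1 / 4 ≤ b.alphaHi κ s
    · have hZ := b.contDiffAt_scalePt h hB lam₀ (u := u) hreg.1 hreg.2
      have hA : ContDiffAt ℝ ∞ ((fun y : 𝔼 3 ↦ ((psiN.symm y : 𝕊 3) : 𝔼 4)) ∘ uncurry (b.scalePt h lam₀)) (u, s) :=
        ContDiffAt.comp (g := fun y : 𝔼 3 ↦ ((psiN.symm y : 𝕊 3) : 𝔼 4)) (f := uncurry (b.scalePt h lam₀)) (u, s)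
          contDiff_coe_psiN_symm.contDiffAt hZ
      exact hθ.contDiffAt.smul (hA.sub hF.contDiffAt)
    · have hopen : IsOpen {p : ℝ × ℝ | b.alphaLo κ p.2 < 1 / 4 ∨ b.alphaHi κ p.2 < 1 / 4} :=
        (isOpen_lt ((b.contDiff_alphaLo κ).continuous.comp continuous_snd) continuous_const).union
          (isOpen_lt ((b.contDiff_alphaHi κ).continuous.comp continuous_snd) continuous_const)
      have hmem : (u, s) ∈ {p : ℝ × ℝ | b.alphaLo κ p.2 < 1 / 4 ∨ b.alphaHi κ p.2 < 1 / 4} := by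
        simp only [mem_setOf_eq]
        rw [not_and_or, not_le, not_le] at hreg
        exact hreg
      refine (contDiffAt_const (c := (0 : 𝔼 4))).congr_of_eventuallyEq ?_
      filter_upwards [hopen.mem_nhds hmem] with p hp
      have : b.regionTheta κ p.2 = 0 := by
        rcases hp with hp | hp
        · simp [regionTheta, regionCut_eq_zero hp.le]
        · simp [regionTheta, regionCut_eq_zero hp.le]
      simp [this]
  have e : uncurry (b.wallScalePiece h F lam₀) = fun p : ℝ × ℝ ↦ F p.2 +
      b.regionTheta κ p.2 • ((((psiN.symm (b.scalePt h lam₀ p.1 p.2)) : 𝕊 3) : 𝔼 4) - F p.2) := by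
    funext p; rfl
  rw [e]; exact hF.add hT

/-- Each stage of the family of a wall frame is `C^∞`. [folklore] -/
theorem contDiff_wallScalePiece_stage (hW : b.IsWallFrame h F) (hB : B.InSouth) (lam₀ u : ℝ) :
    ContDiff ℝ ∞ (b.wallScalePiece h F lam₀ u) := by
  have hc : ContDiff ℝ ∞ (fun t : ℝ ↦ ((u, t) : ℝ × ℝ)) := (contDiff_const (c := u)).prodMk (contDiff_id (E := ℝ))
  have h1 := ContDiff.comp (g := uncurry (b.wallScalePiece h F lam₀)) (f := fun t : ℝ ↦ ((u, t) : ℝ × ℝ))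
    (b.contDiff_wallScalePiece h hW hB lam₀) hc
  have e : uncurry (b.wallScalePiece h F lam₀) ∘ (fun t : ℝ ↦ ((u, t) : ℝ × ℝ)) = b.wallScalePiece h F lam₀ u := by
    funext t; rfl
  rwa [e] at h1

/-- **The family of a wall frame is regular on the content set** (`λ₀ ∈ (0, 1]`, `u ∈ [0, 1]`): there it
is eventually equal to the scaling family. [folklore] -/
theorem deriv_wallScalePiece_ne_zero (hW : b.IsWallFrame h F) (hB : B.InSouth) {lam₀ u : ℝ} (hl : lam₀ ∈ Ioc (0 : ℝ) 1)
    (hu : u ∈ Icc (0 : ℝ) 1) {s : ℝ} (hs : s ∈ b.contentSet h.spike.κ_pos h.spike.seven_le_gapLo h.spike.seven_le_gapHi) :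
    deriv (b.wallScalePiece h F lam₀ u) s ≠ 0 := by
  obtain ⟨hα1, hα2⟩ := b.alpha_ge_of_mem_contentSet h hs
  rw [(b.wallScalePiece_eventuallyEq h hW lam₀ u (by linarith) (by linarith)).deriv_eq]
  exact b.deriv_scalePiece_ne_zero h hB hl hu hs

omit h

/-! ### The shrunk wall frame knot and the isotopy -/

variable {lam₀ : ℝ} (H : b.ShrinkScale hcross ε r A' κ lam₀) (hW : b.IsWallFrame H.cone F)
  (hB : B.InSouth) (hAB : Disjoint (range A) (range B))
include H hW

include hB hAB in
/-- **The family of a wall frame is injective on the content set** (`u ∈ [0, 1]`). [folklore] -/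
theorem injOn_wallScalePiece {u : ℝ} (hu : u ∈ Icc (0 : ℝ) 1) :
    InjOn (b.wallScalePiece H.cone F lam₀ u)
      (b.contentSet H.cone.spike.κ_pos H.cone.spike.seven_le_gapLo H.cone.spike.seven_le_gapHi) := by
  intro s hs s' hs' he
  rw [b.wallScalePiece_eq_scalePiece_of_mem H.cone hW lam₀ u hs, b.wallScalePiece_eq_scalePiece_of_mem H.cone hW lam₀ u hs'] at he
  exact b.injOn_scalePiece H hB hAB hu hs hs' he

include hB in
/-- **The family of a wall frame avoids the walls** (the cone condition for wall points). [folklore] -/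
theorem wallScalePiece_ne {u : ℝ} (hu : u ∈ Icc (0 : ℝ) 1) {s : ℝ}
    (hs : s ∈ b.contentSet H.cone.spike.κ_pos H.cone.spike.seven_le_gapLo H.cone.spike.seven_le_gapHi) {t : ℝ}
    (ht : t ∈ Ico b.alo (b.alo + 1))
    (hts : t ∉ b.contentSet H.cone.spike.κ_pos H.cone.spike.seven_le_gapLo H.cone.spike.seven_le_gapHi) :
    b.wallScalePiece H.cone F lam₀ u s ≠ F t := by
  rw [b.wallScalePiece_eq_of_mem H.cone hW lam₀ u hs, scalePt]
  exact b.cone_of_isWallPt H.cone hB hs (b.scaleFn_mem_Icc01 ⟨H.lam_mem.1.le, H.lam_mem.2⟩ hu κ s) (hW.wall t ht hts)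

variable (F) in
omit hW in
/-- **The shrunk wall frame loop**: the periodisation of the family over `F`. [folklore] -/
def wallShrinkLoop (u : ℝ) : ℝ → 𝔼 4 := periodise b.alo (b.wallScalePiece H.cone F lam₀ u)

include hB in
/-- **The shrunk wall frame loop is a regular loop** for `u ∈ [0, 1]`. [folklore] -/
theorem isRegularLoop_wallShrinkLoop {u : ℝ} (hu : u ∈ Icc (0 : ℝ) 1) : IsRegularLoop (b.wallShrinkLoop F H u) :=
  hW.isRegularLoop.periodise_of_eqOn_compl
    (b.contDiff_wallScalePiece_stage H.cone hW hB lam₀ u) b.seamEps_bounds.1 hW.seam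
    (b.contentSet_subset_seam H.cone) isClosed_Icc (fun _ ht ↦ b.wallScalePiece_eq_of_not_mem H.cone hW hB lam₀ u ht)
    (fun _ hs ↦ b.norm_wallScalePiece_of_mem H.cone hW lam₀ u hs)
    (fun _ hs ↦ b.deriv_wallScalePiece_ne_zero H.cone hW hB H.lam_mem hu hs)

include hB hAB in
/-- **The family of a wall frame is injective on the fundamental domain** for `u ∈ [0, 1]`. [folklore] -/
theorem injOn_wallScalePiece_Ico {u : ℝ} (hu : u ∈ Icc (0 : ℝ) 1) :
    InjOn (b.wallScalePiece H.cone F lam₀ u) (Ico b.alo (b.alo + 1)) :=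
  injOn_Ico_of_eqOn_compl hW.injOn
    (fun _ ht ↦ b.wallScalePiece_eq_of_not_mem H.cone hW hB lam₀ u ht) (b.injOn_wallScalePiece H hW hB hAB hu)
    (fun _ hs _ ht hts ↦ b.wallScalePiece_ne H hW hB hu hs ht hts)

/-- **The knot of the wall frame**: the knot of the simple regular loop `periodise alo F`. [folklore] -/
def wallKnot : Knot :=
  hW.isRegularLoop.toKnot (periodise_simple_iff.2 hW.injOn)

/-- The knot of the wall frame on the circle point of parameter `t`. [folklore] -/
theorem coe_wallKnot_circlePt (t : ℝ) :
    ((b.wallKnot H hW (circlePt t) : 𝕊 3) : 𝔼 4) = periodise b.alo F t :=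
  hW.isRegularLoop.coe_toKnot_circlePt _ t

/-- **The shrunk wall frame knot**: the knot of the shrunk wall frame loop at `u = 1` (southern
content of `b` contracted by the ratio `λ₀` towards the centre `oS`, inside the wall frame).
[folklore] -/
def wallShrinkKnot (hB : B.InSouth) (hAB : Disjoint (range A) (range B)) : Knot :=
  (b.isRegularLoop_wallShrinkLoop H hW hB ⟨zero_le_one, le_rfl⟩).toKnot
    (periodise_simple_iff.2 (b.injOn_wallScalePiece_Ico H hW hB hAB ⟨zero_le_one, le_rfl⟩))

/-- The shrunk wall frame knot on the circle point of parameter `t`. [folklore] -/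
theorem coe_wallShrinkKnot_circlePt (hB : B.InSouth) (hAB : Disjoint (range A) (range B)) (t : ℝ) :
    ((b.wallShrinkKnot H hW hB hAB (circlePt t) : 𝕊 3) : 𝔼 4) = b.wallShrinkLoop F H 1 t :=
  (b.isRegularLoop_wallShrinkLoop H hW hB ⟨zero_le_one, le_rfl⟩).coe_toKnot_circlePt _ t

/-- **The knot of a wall frame is isotopic to its shrunk knot** (a smooth family of modifications on
the content set; isotopy extension). [cite: HirschDT1976, Ch. 8 §1, Thm. 1.3] -/
theorem isIsotopic_wallKnot_wallShrinkKnot (hB : B.InSouth) (hAB : Disjoint (range A) (range B)) :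
    (b.wallKnot H hW).IsIsotopic (b.wallShrinkKnot H hW hB hAB) :=
  IsRegularLoop.isIsotopic_of_modification (G := b.wallScalePiece H.cone F lam₀)
    hW.isRegularLoop hW.injOn
    (b.isRegularLoop_wallShrinkLoop H hW hB ⟨zero_le_one, le_rfl⟩) (b.injOn_wallScalePiece_Ico H hW hB hAB ⟨zero_le_one, le_rfl⟩)
    b.seamEps_bounds.1 hW.seam (b.contDiff_wallScalePiece H.cone hW hB lam₀)
    (b.contentSet_subset_seam H.cone) isClosed_Icc (fun u _ ht ↦ b.wallScalePiece_eq_of_not_mem H.cone hW hB lam₀ u ht)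
    (b.wallScalePiece_zero H.cone hW hB lam₀)
    (fun u _ _ hs ↦ b.norm_wallScalePiece_of_mem H.cone hW lam₀ u hs)
    (fun _ hu _ hs ↦ b.deriv_wallScalePiece_ne_zero H.cone hW hB H.lam_mem hu hs)
    (fun _ hu ↦ b.injOn_wallScalePiece H hW hB hAB hu)
    (fun _ hu _ hs _ ht hts ↦ b.wallScalePiece_ne H hW hB hu hs ht hts)

omit hW

/-! ### The instance `F = spikePiece` -/

/-- Over the spiked piece function the knot of the wall frame is the spiked knot. [folklore] -/
theorem wallKnot_spikePiece (hA : A.InNorth) (hAB : Disjoint (range A) (range B)) :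
    b.wallKnot H (b.isWallFrame_spikePiece H.cone hA hAB) = b.spikeKnot H.cone.spike hAB := rfl

/-- Over the spiked piece function the shrunk wall frame knot is the shrunk knot of
`ScalingFamily.lean`. [folklore] -/
theorem wallShrinkKnot_spikePiece (hA : A.InNorth) (hB : B.InSouth) (hAB : Disjoint (range A) (range B)) :
    b.wallShrinkKnot H (b.isWallFrame_spikePiece H.cone hA hAB) hB hAB = b.shrinkKnot H hA hB hAB := rfl

end BandData

end Literature.Topology.FourManifolds
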